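import Summits.HodgeConjecture.HodgeCM.PerL34.FockUnitaryAction_1

/-! PORT of `HodgeCM/PerL34/FockUnitaryAction.lean` (HodgeCMPerL run 82) — part 2: continuation of `Summits.HodgeConjecture.HodgeCM.PerL34.FockUnitaryAction_1` (split at a top-level declaration boundary by port_pkg.py; scope re-opened below; declarations unchanged). -/

-- port_pkg: scope re-opened for this part (file-level context, then the namespace/section stack open at the cut)
set_option autoImplicit false
open MvPolynomial Complex MeasureTheory
open scoped Real InnerProductSpace Matrix
namespace HodgeCM.PerL34.Fock.Hermite
noncomputable section
variable {σ : Type*} [Fintype σ] [DecidableEq σ]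
omit [DecidableEq σ] in
/-- (Ported verbatim from the HodgeCMPerL package; no docstring in the source.) -/
theorem fockWeight_smul_of_norm_eq_one {c : ℂ} (hc : ‖c‖ = 1) (z : σ → ℂ) : fockWeight (c • z) = fockWeight z := by
  unfold fockWeight
  congr 2
  refine Finset.sum_congr rfl fun k _ => ?_
  rw [Pi.smul_apply, smul_eq_mul, norm_mul, hc, one_mul]

/-- `ζ_α e^{−(π/2)|z|²}` evaluated at `c̄ z`, `c ∈ S¹`, is `c̄^{|α|} ζ_α e^{−(π/2)|z|²}`. -/
theorem fockFun_zeta_scalarU (c : Circle) (α : σ →₀ ℕ) (z : σ → ℂ) :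
    fockFun (zeta α) (invSubst (scalarU c) z) = (starRingEnd ℂ (c : ℂ)) ^ mdeg α * fockFun (zeta α) z := by
  have hc : ‖starRingEnd ℂ (c : ℂ)‖ = 1 := by rw [Complex.norm_conj, Circle.norm_coe]
  rw [invSubst_scalarU, fockFun, fockFun, fockWeight_smul_of_norm_eq_one hc, eval_smul_zeta]
  ring

/-- **The `K`-types of the Fock model [Fo89 p0182 L35–L39]** ("U(1) acts on 𝓟_k … by the representation
e^{iθ} → e^{−ikθ}"): the centre `e^{iθ}·1 ∈ U(σ)` acts on the basis vector `ζ_α e^{−(π/2)|z|²}`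
(`fockVec α = fockBasis α`) by the character `e^{−i|α|θ}`; hence Folland's space `𝓟_k` of homogeneous degree-`k`
polynomial vectors lies in the `e^{−ikθ}`-eigenspace. -/
theorem fockRep_scalarU_fockVec (c : Circle) (α : σ →₀ ℕ) :
    fockRep (scalarU c) (fockVec α) = ((starRingEnd ℂ (c : ℂ)) ^ mdeg α) • fockVec α := by
  apply Subtype.ext
  rw [fockRep_apply, coe_fockOp, coe_fockVec, Submodule.coe_smul, coe_fockVec, koopman_apply, zetaL2,
    Lp.toLp_compMeasurePreserving, ← MemLp.toLp_const_smul]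
  exact MemLp.toLp_congr _ _ (Filter.EventuallyEq.of_eq (funext fun z => fockFun_zeta_scalarU c α z))

/-- The same on the Hilbert basis `fockBasis` of [Fo89 Thm (1.63)]. -/
theorem fockRep_scalarU_fockBasis (c : Circle) (α : σ →₀ ℕ) :
    fockRep (scalarU c) (fockBasis α) = ((starRingEnd ℂ (c : ℂ)) ^ mdeg α) • fockBasis α := by
  rw [fockBasis_apply, fockRep_scalarU_fockVec]

/-! ## 6. Transport to `L²(ℝ^σ)` by the Bargmann unitary [Fo89 §1.6 p0037 L20–L24; p0045 L45] -/

/-- The `U(σ)`-action transported to `L²(ℝ^σ)` through the Bargmann unitary `bargmann : L²(ℝ^σ) ≃ 𝓕`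
(the restriction of the metaplectic representation to `U(σ) ⊂ Sp`, det^{-1/2} discarded, [Fo89 Prop (4.39),
p0162 L1] read in the Schrödinger model through `B`, cf. `μ(𝒜) = B⁻¹ν(𝒜_c)B` [p0162 L5]). -/
def schrodingerU (U : Matrix.unitaryGroup σ ℂ) :
    Lp ℂ 2 (volume : Measure (σ → ℝ)) ≃ₗᵢ[ℂ] Lp ℂ 2 (volume : Measure (σ → ℝ)) :=
  (bargmann.trans (fockRep U)).trans bargmann.symm

/-- (Ported verbatim from the HodgeCMPerL package; no docstring in the source.) -/
theorem schrodingerU_apply (U : Matrix.unitaryGroup σ ℂ) (f : Lp ℂ 2 (volume : Measure (σ → ℝ))) :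
    schrodingerU U f = bargmann.symm (fockRep U (bargmann f)) := rfl

/-- (Ported verbatim from the HodgeCMPerL package; no docstring in the source.) -/
theorem schrodingerU_one (f : Lp ℂ 2 (volume : Measure (σ → ℝ))) :
    schrodingerU (1 : Matrix.unitaryGroup σ ℂ) f = f := by
  rw [schrodingerU_apply, map_one, LinearIsometryEquiv.coe_one, id, LinearIsometryEquiv.symm_apply_apply]

/-- (Ported verbatim from the HodgeCMPerL package; no docstring in the source.) -/
theorem schrodingerU_mul (U V : Matrix.unitaryGroup σ ℂ) (f : Lp ℂ 2 (volume : Measure (σ → ℝ))) :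
    schrodingerU (U * V) f = schrodingerU U (schrodingerU V f) := by
  rw [schrodingerU_apply, schrodingerU_apply, schrodingerU_apply, LinearIsometryEquiv.apply_symm_apply,
    map_mul, LinearIsometryEquiv.coe_mul, Function.comp_apply]

/-- **Hermite functions are the `K`-types of `L²(ℝ^σ)`**: under the transported action the centre `e^{iθ}·1`
acts on the Hermite function `h_α` ([Fo89 §1.7], `hermiteL2 α`, an orthonormal basis of `L²(ℝ^σ)` by the run-27
file `FockHermiteComplete`) by `e^{−i|α|θ}`. -/
theorem schrodingerU_scalarU_hermiteL2 (c : Circle) (α : σ →₀ ℕ) :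
    schrodingerU (scalarU c) (hermiteL2 α) = ((starRingEnd ℂ (c : ℂ)) ^ mdeg α) • hermiteL2 (σ := σ) α := by
  rw [schrodingerU_apply, bargmann_hermiteL2, fockRep_scalarU_fockVec, map_smul, bargmann_symm_fockVec]

end

end HodgeCM.PerL34.Fock.Hermite
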